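import Summits.AnomalousDissipation.AnomalousDissipation.Theorems.SawtoothPulseCascadeK1LocalisedCascadeCanonicalStripStepsLog2
import Summits.AnomalousDissipation.AnomalousDissipation.Theorems.SawtoothPulseCascadeK1LocalisedCascadeCanonicalBlocksMax

/-!
# K1loc, line `Spectral` / thin start — helper: THE (T-H) STEP ALONG THE FAT SCHEDULE `K_j = K₀·25^j` (numeric-layer TEMPLATE)

Helper file of the prover lane on the crux `K1LocalisedCascade` (stmt-AnomalousDissipation-19491), route `SawtoothPulseCascade`
(S-B/S-C assembly seat; the LEDGER ASSEMBLY, numeric layer).  First of the six per-phase instances that turn the packaged class steps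
(`…CanonicalStripStepsLog2`, `…CanonicalRatioStepsLog2`) into the hypotheses of `K1Ledger.From.k1Localised_of_resolved_ledger` with
EVERY structural / scalar hypothesis discharged: shape `γ = G = 8`, `d = 2`, `N₀ = 1`, `ρN = 2`; fat schedule `K_j = K₀·25^j`
(`K₀ ≥ 6`), low-fibre window `K′_j = 5K_j`; canonical blocks `Λ_m = K_j2^m` with margin `β = 2` (`q_n/q_d = 2/1`), lower cut-offs of
the `max` family with slope `t = 1/2` (feed = the off-cone class of `a_j` at threshold `K_j`, slope `|k₀| ≤ 4|k₁|`), block count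
`M_b = 7j + 12`, rounding target `η_j = (ε/(A₀·8π·4096·K₀))·1600^{−j}`.  Result (`lowFibre_hstep_fat_le`):
  `T_j(5K_j) ≤ S_j(K_j) + ((√J_T(j) + √O_j(K_j))² + ((1+γ)^{2j}/(K_j·2^{7j+12}))²)`,
  `J_T(j) = 3·r₀²·((4/3)ε² + 64·2^j·A₀/K_j + 8(7j+12)·A₀²·(M_jδ_j)/π)`,
with the NUMERIC constants `r₀ = 4/π + (2/π)log 2 + 1/8 + 1/(64π)` (log cut-off ratio), `A₀ = 4/π + (2/π)log 15 + 1/6 + 1/(36π)`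
(log trapezoid constant), `M_j = max 1 √(2log(1/η_j))` (zone depth; `M_jδ_j` is turned into a geometric majorant by
`K1Window.zoneDepth_le_affine` of `…PhaseSums`).  The only hypothesis left is `M_jδ_j < π/2` (a condition on `δ₀` vs `K₀, ε`).
No definitions; no statement about the crux. [cite: Grafakos2014, Prop. 3.1.2 (5), Prop. 3.2.7 (3), §3.1.3]
[cite: ElgindiLissMattingly2025, §1 (slope ±1 branches)] [problem: turb]
-/

-- `Summit.<Summit>.<Problem>`: single-conjunct summit, the duplicate namespace segment is deliberate.
set_option linter.dupNamespace false

noncomputable section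

namespace Summit.AnomalousDissipation.AnomalousDissipation.Theorems.SawtoothPulseCascade.K1Window

open MeasureTheory Set Filter Topology UnitAddTorus Function Complex Metric
open scoped Real ENNReal
open Literature.Analysis Literature.Analysis.FunctionSpaces Literature.Analysis.FunctionSpaces.Torus Literature.Analysis.FluidPDE
open Literature.Analysis.FluidPDE.ShearStage
open Literature.Analysis.FluidPDE.SawtoothCascade Literature.Analysis.FluidPDE.SawtoothCascade.CascadeParams
open Summit.AnomalousDissipation.AnomalousDissipation.Theorems.SawtoothPulseCascade.K1Start
open Summit.AnomalousDissipation.AnomalousDissipation.Theorems.SawtoothPulseCascade.K1Flat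
open Summit.AnomalousDissipation.AnomalousDissipation.Theorems.SawtoothPulseCascade.K1Ledger.From

/-- **The log cut-off ratio of the fat (T-H) blocks is at most `r₀ = 4/π + (2/π)log 2 + 1/8 + 1/(64π)`** (max family, `t = 1/2`,
`β = 2`, `Λ₀ ≥ 6`: `r* = (5Λ₀/2 + 1)/(3Λ₀/2 − 1) ≤ 2` and gap `3Λ₀/2 − 1 ≥ 8`). [folklore] -/
theorem fat_logCutoff_le {Λ0 : ℕ} (hΛ0 : 6 ≤ Λ0) (m : ℕ) :
    4 / π + 2 / π * Real.log ((((max (2 * 1 * (Λ0 * 2 ^ m) / 4) 0 : ℕ) : ℝ) + ((2 * (Λ0 * 2 ^ m) / 1 : ℕ) : ℝ)) /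
        (((2 * (Λ0 * 2 ^ m) / 1 : ℕ) : ℝ) - ((max (2 * 1 * (Λ0 * 2 ^ m) / 4) 0 : ℕ) : ℝ))) +
      1 / (((2 * (Λ0 * 2 ^ m) / 1 : ℕ) : ℝ) - ((max (2 * 1 * (Λ0 * 2 ^ m) / 4) 0 : ℕ) : ℝ)) +
      1 / (π * (((2 * (Λ0 * 2 ^ m) / 1 : ℕ) : ℝ) - ((max (2 * 1 * (Λ0 * 2 ^ m) / 4) 0 : ℕ) : ℝ)) ^ 2) ≤
    4 / π + 2 / π * Real.log 2 + 1 / 8 + 1 / (π * 8 ^ 2) := by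
  have h1 : 2 * 1 * 2 ≤ 1 * 4 := by norm_num
  have h2 : 0 * 2 ≤ 1 * Λ0 := by simp
  have h3 : 1 * 1 * Λ0 + 2 * 1 * 2 ≤ 2 * 2 * Λ0 := by omega
  have hQ := canonMax_Q₁_lt_Q₂ (u' := 1) (v' := 4) (Y₀ := 0) (tn := 1) (td := 2) (qn := 2) (qd := 1) (Λ0 := Λ0)
    (by norm_num) (by norm_num) (by norm_num) h1 h2 h3 m
  have hr := canonMax_r_le (u' := 1) (v' := 4) (Y₀ := 0) (tn := 1) (td := 2) (qn := 2) (qd := 1) (Λ0 := Λ0)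
    (by norm_num) (by norm_num) (by norm_num) h1 h2 h3 m
  have hgap := canonMax_gap_le (u' := 1) (v' := 4) (Y₀ := 0) (tn := 1) (td := 2) (qn := 2) (qd := 1) (Λ0 := Λ0)
    (by norm_num) (by norm_num) (by norm_num) h1 h2 h3 m
  have hΛ0r : (6 : ℝ) ≤ Λ0 := by exact_mod_cast hΛ0
  -- `r* ≤ 2` and the gap `≥ 8`
  have hden : (0 : ℝ) < (((2 : ℕ) : ℝ) / ((1 : ℕ) : ℝ) - ((1 : ℕ) : ℝ) / ((2 : ℕ) : ℝ)) * (Λ0 : ℝ) - 1 := by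
    push_cast; linarith
  have hrs2 : ((((1 : ℕ) : ℝ) / ((2 : ℕ) : ℝ) + ((2 : ℕ) : ℝ) / ((1 : ℕ) : ℝ)) * (Λ0 : ℝ) + 1) /
      ((((2 : ℕ) : ℝ) / ((1 : ℕ) : ℝ) - ((1 : ℕ) : ℝ) / ((2 : ℕ) : ℝ)) * (Λ0 : ℝ) - 1) ≤ 2 := by
    rw [div_le_iff₀ hden]
    push_cast; linarith
  have hgap8 : (8 : ℝ) ≤ (((2 : ℕ) : ℝ) / ((1 : ℕ) : ℝ) - ((1 : ℕ) : ℝ) / ((2 : ℕ) : ℝ)) * (Λ0 : ℝ) - 1 := by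
    push_cast; linarith
  have h := logCutoff_le_of_gap hQ hr (by norm_num : (0 : ℝ) < 8) (hgap8.trans hgap)
  refine h.trans ?_
  have hpos : 0 < ((((1 : ℕ) : ℝ) / ((2 : ℕ) : ℝ) + ((2 : ℕ) : ℝ) / ((1 : ℕ) : ℝ)) * (Λ0 : ℝ) + 1) /
      ((((2 : ℕ) : ℝ) / ((1 : ℕ) : ℝ) - ((1 : ℕ) : ℝ) / ((2 : ℕ) : ℝ)) * (Λ0 : ℝ) - 1) := by
    refine div_pos ?_ hden
    push_cast; linarith
  exact logKernel_mono hpos hrs2 (by norm_num) le_rfl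

section Cascade

variable (P : CascadeParams)

set_option maxHeartbeats 400000 in
/-- **(T-H) ALONG THE FAT SCHEDULE** (see the file header): for every phase `j`, with `K_j = K₀·25^j`, `K₀ ≥ 6`,
`T_j(5K_j) ≤ S_j(K_j) + ((√J_T(j) + √O_j(K_j))² + ((1+γ)^{2j}/(K_j2^{7j+12}))²)`. [cite: Grafakos2014, Prop. 3.1.2 (5), Prop. 3.2.7 (3), §3.1.3] -/
theorem lowFibre_hstep_fat_le (hγ : P.γ = 8) (hδ₀ : 0 < P.δ₀) (hd : P.d = 2) (hN₀ : P.N₀ = 1) (hρN : P.ρN = 2)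
    (a b : ℕ → UnitAddTorus (Fin 2) → ℝ) (has : ∀ j, IsSmooth (a j)) (h0 : a 0 = datum)
    (hb : ∀ j, b j = a j ∘ shearMap 0 1 (amp ⟨P.U j, P.U_periodic j, P.contDiff_U (P.δ_pos hδ₀ (by rw [hd]; norm_num) j)⟩ P.γ))
    (hab : ∀ j, a (j + 1) = b j ∘ shearMap 1 0 (amp ⟨P.U j, P.U_periodic j, P.contDiff_U (P.δ_pos hδ₀ (by rw [hd]; norm_num) j)⟩ P.γ))
    {K₀ : ℕ} (hK₀ : 6 ≤ K₀) {ε : ℝ} (hε : 0 < ε) (j : ℕ)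
    (hMδ : max 1 (Real.sqrt (2 * Real.log (1 / (ε / ((4 / π + 2 / π * Real.log 15 + 1 / 6 + 1 / (π * 6 ^ 2)) * π * 8 *
        4096 * K₀) * (1 / 1600) ^ j)))) * P.δ j < π / 2) :
    ∑' k : Fin 2 → ℤ, (if |k 1| < ((5 * (K₀ * 25 ^ j) : ℕ) : ℤ) then (1 : ℝ) else 0) *
        ‖mFourierCoeff (fun x => (b j x : ℂ)) k‖ ^ 2 ≤
      ∑' k : Fin 2 → ℤ, (if |k 0| < ((K₀ * 25 ^ j : ℕ) : ℤ) then (1 : ℝ) else 0) * ‖mFourierCoeff (fun x => (a j x : ℂ)) k‖ ^ 2 +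
      ((Real.sqrt (3 * (4 / π + 2 / π * Real.log 2 + 1 / 8 + 1 / (π * 8 ^ 2)) ^ 2 *
            (4 / 3 * ε ^ 2 + 64 * 2 ^ j * (4 / π + 2 / π * Real.log 15 + 1 / 6 + 1 / (π * 6 ^ 2)) / ((K₀ * 25 ^ j : ℕ) : ℝ) +
              8 * ((7 * j + 12 : ℕ) : ℝ) * (4 / π + 2 / π * Real.log 15 + 1 / 6 + 1 / (π * 6 ^ 2)) ^ 2 *
                (max 1 (Real.sqrt (2 * Real.log (1 / (ε / ((4 / π + 2 / π * Real.log 15 + 1 / 6 + 1 / (π * 6 ^ 2)) * π * 8 *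
                  4096 * K₀) * (1 / 1600) ^ j)))) * P.δ j) / π)) +
          Real.sqrt (∑' k : Fin 2 → ℤ, (if ((K₀ * 25 ^ j : ℕ) : ℤ) ≤ |k 0| ∧ ((1 : ℕ) : ℤ) * |k 0| ≤ ((4 : ℕ) : ℤ) * |k 1|
            then (1 : ℝ) else 0) * ‖mFourierCoeff (fun x => (a j x : ℂ)) k‖ ^ 2)) ^ 2 +
        ((1 + P.γ) ^ (2 * j) / (((K₀ * 25 ^ j) * 2 ^ (7 * j + 12) : ℕ) : ℝ)) ^ 2) := by
  -- the schedule and the shape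
  set Λ0 : ℕ := K₀ * 25 ^ j with hΛ0def
  have hΛ06 : 6 ≤ Λ0 := hK₀.trans (Nat.le_mul_of_pos_right _ (pow_pos (by norm_num) j))
  have hΛ01 : 1 ≤ Λ0 := le_trans (by norm_num) hΛ06
  have hΛ0r : (6 : ℝ) ≤ Λ0 := by exact_mod_cast hΛ06
  have hΛ0pos : (0 : ℝ) < Λ0 := by linarith
  have hγ' : P.γ = ((8 : ℕ) : ℝ) := by rw [hγ]; norm_num
  have hd' : 0 < P.d := by rw [hd]; norm_num
  have hN₀' : 1 ≤ P.N₀ := by rw [hN₀]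
  have hρN' : 1 ≤ P.ρN := by rw [hρN]; norm_num
  have hNj : (P.N j : ℝ) = 2 ^ j := by rw [CascadeParams.N, hN₀, hρN]; push_cast; ring
  have hK : 5 * (K₀ * 25 ^ j) * 1 + 2 * Λ0 < 8 * 1 * Λ0 := by rw [hΛ0def]; omega
  -- the `max`-family cut-offs
  have h1 : 2 * 1 * 2 ≤ 1 * 4 := by norm_num
  have h2 : 0 * 2 ≤ 1 * Λ0 := by simp
  have h3 : 1 * 1 * Λ0 + 2 * 1 * 2 ≤ 2 * 2 * Λ0 := by omega
  set A₀ : ℝ := 4 / π + 2 / π * Real.log 15 + 1 / 6 + 1 / (π * 6 ^ 2) with hA₀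
  set r₀ : ℝ := 4 / π + 2 / π * Real.log 2 + 1 / 8 + 1 / (π * 8 ^ 2) with hr₀
  set η : ℝ := ε / (A₀ * π * 8 * 4096 * K₀) * (1 / 1600) ^ j with hη
  have hπ := Real.pi_pos
  have hlog15 : 0 ≤ Real.log 15 := Real.log_nonneg (by norm_num)
  have hA₀pos : 0 < A₀ := by rw [hA₀]; positivity
  have hK₀r : (6 : ℝ) ≤ K₀ := by exact_mod_cast hK₀
  have hηpos : 0 < η := by rw [hη]; positivity
  -- the packaged step
  have hstep := lowFibre_hstep_canonicalLog2_le P hγ' hδ₀ hd' hN₀' hρN' a b has h0 hb hab j (K := 5 * (K₀ * 25 ^ j))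
    (u' := 1) (v' := 4) (qn := 2) (qd := 1) (Λ0 := Λ0) (by norm_num) hK hΛ01
    (fun m => max (2 * 1 * (Λ0 * 2 ^ m) / 4) 0)
    (fun m => canonMax_Q₁_lt_Q₂ (by norm_num) (by norm_num) (by norm_num) h1 h2 h3 m)
    (fun m => canonMax_feed (by norm_num) 0 Λ0 m) (rs := r₀) (fun m => fat_logCutoff_le hΛ06 m) (7 * j + 12) hηpos hMδ
  -- the exact constants of the canonical step at `K = 5Λ₀`, `q = 2/1`, `G = 8`
  have eratio : ((((5 * (K₀ * 25 ^ j) : ℕ) : ℝ)) * ((1 : ℕ) : ℝ) + (((2 : ℕ) : ℝ) + ((8 : ℕ) : ℝ) * ((1 : ℕ) : ℝ)) * Λ0) /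
      ((((8 : ℕ) : ℝ) * ((1 : ℕ) : ℝ) - ((2 : ℕ) : ℝ)) * Λ0 - ((5 * (K₀ * 25 ^ j) : ℕ) : ℝ) * ((1 : ℕ) : ℝ)) = 15 := by
    rw [hΛ0def]; push_cast; field_simp; ring
  have eD : ((((8 : ℕ) : ℝ) * ((1 : ℕ) : ℝ) - ((2 : ℕ) : ℝ)) * Λ0 - ((5 * (K₀ * 25 ^ j) : ℕ) : ℝ) * ((1 : ℕ) : ℝ)) / ((1 : ℕ) : ℝ) =
      Λ0 := by
    rw [hΛ0def]; push_cast; ring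
  have eτ : ((1 : ℕ) : ℝ) / (2 * ((((8 : ℕ) : ℝ) * ((1 : ℕ) : ℝ) - ((2 : ℕ) : ℝ)) * Λ0 - ((5 * (K₀ * 25 ^ j) : ℕ) : ℝ) * ((1 : ℕ) : ℝ))) =
      1 / (2 * (Λ0 : ℝ)) := by
    rw [hΛ0def]; push_cast; ring
  set As : ℝ := 4 / π + 2 / π * Real.log ((((5 * (K₀ * 25 ^ j) : ℕ) : ℝ) * ((1 : ℕ) : ℝ) + (((2 : ℕ) : ℝ) + ((8 : ℕ) : ℝ) * ((1 : ℕ) : ℝ)) * Λ0) /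
      ((((8 : ℕ) : ℝ) * ((1 : ℕ) : ℝ) - ((2 : ℕ) : ℝ)) * Λ0 - ((5 * (K₀ * 25 ^ j) : ℕ) : ℝ) * ((1 : ℕ) : ℝ))) +
      1 / (((((8 : ℕ) : ℝ) * ((1 : ℕ) : ℝ) - ((2 : ℕ) : ℝ)) * Λ0 - ((5 * (K₀ * 25 ^ j) : ℕ) : ℝ) * ((1 : ℕ) : ℝ)) / ((1 : ℕ) : ℝ)) +
      1 / (π * (((((8 : ℕ) : ℝ) * ((1 : ℕ) : ℝ) - ((2 : ℕ) : ℝ)) * Λ0 - ((5 * (K₀ * 25 ^ j) : ℕ) : ℝ) * ((1 : ℕ) : ℝ)) / ((1 : ℕ) : ℝ)) ^ 2)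
    with hAs
  have hAsle : As ≤ A₀ := by
    rw [hAs, eratio, eD, hA₀]
    have h6 : 1 / (Λ0 : ℝ) ≤ 1 / 6 := one_div_le_one_div_of_le (by norm_num) hΛ0r
    have h36 : 1 / (π * (Λ0 : ℝ) ^ 2) ≤ 1 / (π * 6 ^ 2) :=
      one_div_le_one_div_of_le (by positivity) (mul_le_mul_of_nonneg_left (pow_le_pow_left₀ (by norm_num) hΛ0r 2) hπ.le)
    linarith
  have hAs0 : 0 ≤ As := by
    rw [hAs, eratio, eD]
    positivity
  set Mδ : ℝ := max 1 (Real.sqrt (2 * Real.log (1 / η))) * P.δ j with hMδdef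
  have hMδ0 : 0 ≤ Mδ := by
    rw [hMδdef]
    exact mul_nonneg (le_trans zero_le_one (le_max_left _ _)) (P.δ_pos hδ₀ hd' j).le
  refine le_add_sq_sqrt_add_mono hstep ?_
  -- the junk: `As ≤ A₀`, `τ₀ = 1/(2Λ₀)`, `N_j = 2^j`, the rounding product collapses to `As·ε/A₀ ≤ ε`
  rw [eτ, hNj]
  have hX : As * π * ((8 : ℕ) : ℝ) * η * Λ0 / 2 ^ j * 2 ^ (7 * j + 12) = As * (ε / A₀) := by
    have e2 : (2 : ℝ) ^ (7 * j + 12) = 4096 * 128 ^ j := by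
      rw [pow_add, pow_mul]; norm_num; ring
    have p1 : ((1 : ℝ) / 1600) ^ j * (25 : ℝ) ^ j * (128 : ℝ) ^ j = (2 : ℝ) ^ j := by
      rw [← mul_pow, ← mul_pow]; norm_num
    have eΛ : (Λ0 : ℝ) = (K₀ : ℝ) * 25 ^ j := by rw [hΛ0def]; push_cast; ring
    have hne1 : Real.pi * 8 * 4096 * (K₀ : ℝ) ≠ 0 := by positivity
    have hne2 : (2 : ℝ) ^ j ≠ 0 := pow_ne_zero _ two_ne_zero
    have hne3 : A₀ ≠ 0 := hA₀pos.ne'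
    rw [hη, e2, eΛ]
    push_cast
    calc As * π * 8 * (ε / (A₀ * π * 8 * 4096 * (K₀ : ℝ)) * (1 / 1600) ^ j) * ((K₀ : ℝ) * 25 ^ j) / 2 ^ j * (4096 * 128 ^ j)
        = As * (ε / A₀) * ((Real.pi * 8 * 4096 * (K₀ : ℝ)) / (Real.pi * 8 * 4096 * K₀)) *
            ((((1 : ℝ) / 1600) ^ j * 25 ^ j * 128 ^ j) / 2 ^ j) := by
          field_simp
      _ = As * (ε / A₀) := by rw [p1, div_self hne1, div_self hne2]; ring
  have hXle : As * π * ((8 : ℕ) : ℝ) * η * Λ0 / 2 ^ j * 2 ^ (7 * j + 12) ≤ ε := by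
    rw [hX]
    calc As * (ε / A₀) ≤ A₀ * (ε / A₀) := mul_le_mul_of_nonneg_right hAsle (by positivity)
      _ = ε := by field_simp
  have hX0 : 0 ≤ As * π * ((8 : ℕ) : ℝ) * η * Λ0 / 2 ^ j * 2 ^ (7 * j + 12) := by rw [hX]; positivity
  have hr₀0 : 0 ≤ 3 * r₀ ^ 2 := by positivity
  refine mul_le_mul_of_nonneg_left ?_ hr₀0
  refine add_le_add (add_le_add ?_ ?_) ?_
  · exact mul_le_mul_of_nonneg_left (pow_le_pow_left₀ hX0 hXle 2) (by norm_num)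
  · -- kernel layer: `128·2^j·As·(1/(2Λ₀)) ≤ 64·2^j·A₀/Λ₀`
    have h2j : (0 : ℝ) ≤ 2 ^ j := by positivity
    rw [show (128 : ℝ) * 2 ^ j * As * (1 / (2 * (Λ0 : ℝ))) = 64 * 2 ^ j * As / Λ0 by field_simp; ring]
    exact div_le_div_of_nonneg_right (mul_le_mul_of_nonneg_left hAsle (by positivity)) hΛ0pos.le
  · -- zone part: `As² ≤ A₀²`
    have : As ^ 2 ≤ A₀ ^ 2 := pow_le_pow_left₀ hAs0 hAsle 2
    have hMb : (0 : ℝ) ≤ ((7 * j + 12 : ℕ) : ℝ) := by positivity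
    have := mul_le_mul_of_nonneg_left (mul_le_mul_of_nonneg_right this hMδ0) (by positivity : (0 : ℝ) ≤ 8 * ((7 * j + 12 : ℕ) : ℝ))
    have e : ∀ A : ℝ, 8 * ((7 * j + 12 : ℕ) : ℝ) * A ^ 2 * Mδ / π = 8 * ((7 * j + 12 : ℕ) : ℝ) * (A ^ 2 * Mδ) / π := fun A => by ring
    rw [e, e]
    exact div_le_div_of_nonneg_right this hπ.le

end Cascade

end Summit.AnomalousDissipation.AnomalousDissipation.Theorems.SawtoothPulseCascade.K1Window
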